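import Literature.Topology.FourManifolds.SphereTrisectionsSectors
import HarnessLib

/-!
# The standard trisections of the round `S⁴` ((d′) `sphere_gkTrisections`): decomposition record

Topic `Literature/Topology/FourManifolds`; theorems only.  The named fact
`Literature.Topology.FourManifolds.sphere_gkTrisections` (`TrisectionFunctorGK.lean`, (d′): for
every `m` the round `S⁴` carries a balanced `(3 + 3m, 1 + m)`-trisection with corners whose kernel
triple is the `m`-fold algebraic stabilisation of the genus-`3` triple; D. Gay, R. Kirby, Geom.
Topol. 20 (2016), §2 with Def. 8–9 and Lemma 10; A. Abrams, D. Gay, R. Kirby, Geom. Topol. 22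
(2018), Thm. 5) has two printed inputs: the genus-`0` trisection of `S⁴` (Gay–Kirby §2, first
example) — a THEOREM of the tree (`sphereSector_isBalancedGKTrisection_holds`,
`SphereTrisectionsSectors.lean`: the three sectors, the immersion and corner charts, the
handlebodies) — and the compatibility of geometric and algebraic stabilisation, the EXISTING named
fact (c′) `exists_stabilized_gkTrisection` (Gay–Kirby Def. 8 / Lemma 10 with Abrams–Gay–Kirby
Def. 3 and Thm. 5).  Hence the decomposition of (d′) has ONE unproved child, (c′), and the
assembly is the landed `sphere_gkTrisections_of_stabilization` (iterate (c′) from the genus-`0`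
base; the algebra `stabilizeIter` and the `π₁` bookkeeping are theorems of
`SphereTrisections*.lean`).  The seat's finer, tree-internal reduction of (c′) on `S⁴` to "one
implant in joint-chart datum form" (`sphere_gkTrisections_of_jointChartDatum_stabilizeOne_step`,
`TrisectionStabilizationDatumAssemblyOne.lean`) is a step of the proof of Lemma 10, not a
published statement, and is deliberately not minted as a fact.

No statement is introduced.  (c′) is not (d′) reworded: it is the stabilisation step for an
ARBITRARY trisected closed 4-manifold, (d′) the existence of the whole standard family on `S⁴`.

## References

* D. Gay, R. Kirby, *Trisecting 4-manifolds*, Geom. Topol. 20 (2016) 3097–3132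
  (arXiv:1205.1565): §2 (the trisections of `S⁴`), Def. 8, Def. 9 and Fig. 3, Lemma 10.
  [GayKirby2016]
* A. Abrams, D. Gay, R. Kirby, *Group trisections and smooth 4-manifolds*, Geom. Topol. 22 (2018)
  1537–1545: Def. 3, Thm. 5 (p. 1541). [AbramsGayKirby2018]
-/

noncomputable section

namespace Literature.Topology.FourManifolds

/-- **Assembly: (d′) `sphere_gkTrisections` from its single unproved printed input (c′)
`exists_stabilized_gkTrisection`** (the genus-`0` trisection of the round `S⁴` being the theorem
`sphereSector_isBalancedGKTrisection_holds`), by `sphere_gkTrisections_of_stabilization`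
(`SphereTrisectionsSectors.lean`). [cite: GayKirby2016, §2 (arXiv p. 5), Def. 8 and Lemma 10] [cite: AbramsGayKirby2018, Def. 3 (p. 1540) and Thm. 5 (p. 1541)] -/
theorem sphere_gkTrisections_holds_of :
    exists_stabilized_gkTrisection.{0} → sphere_gkTrisections :=
  fun hc => sphere_gkTrisections_of_stabilization hc

end Literature.Topology.FourManifolds
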